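import Summits.AtomisticToContinuum.HydrodynamicLimit.Theorems.InformationPercolationEngineChaosClosesEulerShellTime
import HarnessLib

/-!
# BF18 shell for functions (crux `ChaosClosesEuler`, stmt-AtomisticToContinuum-15141, line `Sketch`,
# stub `stub_bf18Shell`) — helper: the weighted relative-energy inequality (`stub_bf18ShellWin`)

WHAT. The pure one-dimensional bookkeeping heart of the BF18 relative-energy shell. Write
`cut(s) = ζ((τ₀ + Δ − s)/Δ)` (`ζ = Real.smoothTransition`) for the smooth decreasing time cut-off of a window
`[τ₀, τ₀ + Δ] ⊆ [0, t]` and `w = −cut' ≥ 0` for its weight (a probability density on the window). The space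
integral `F ≥ 0` of the relative energy splits as `F = XE − XM + XC − XS + XP` (energy, momentum-tested,
continuity-tested, entropy-tested, pressure parts), each part being known through its time evolution:
`XE(τ) ≤ XE(0) + δ`, `|XM(τ) − XM(0) − ∫₀^τ GM| ≤ δ`, `XC(τ) − XC(0) = ∫₀^τ GC`, the entropy input already in
weighted form `∫ cut · GS − ∫ w · XS + XS(0) ≤ δ`, and `XP(τ) − XP(0) = ∫₀^τ GP`; the sources recombine on
`(0, t)` into `−GM + GC − GS + GP + GD = Rp ≤ C F` with `∫₀^τ GD = 0`. CONCLUSION (`stub_bf18ShellWin`):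
`∫₀ᵗ w F ≤ F(0) + 3δ + C ∫₀^{τ₀+Δ} F`, the weighted inequality fed to the windowed Grönwall lemma.

PROOF. `∫ w F = ∫ w XE − ∫ w XM + ∫ w XC − ∫ w XS + ∫ w XP`; `∫ w XE ≤ XE(0) + δ` (unit mass, `w ≥ 0`);
`|∫ w XM − (XM(0) + ∫ cut · GM)| ≤ δ` and `∫ w XC = XC(0) + ∫ cut · GC`, `∫ w XP = XP(0) + ∫ cut · GP` by the
weighted Fubini identity `∫ w(τ) ∫₀^τ G dτ = ∫ cut · G` of the imported time bookkeeping; the entropy input is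
used as is. Summing, `∫ w F ≤ F(0) + 3δ + ∫ cut · (−GM + GC − GS + GP)`, and the last integral equals
`∫ cut · Rp − ∫ cut · GD = ∫ cut · Rp ≤ C ∫₀^{τ₀+Δ} F` (`∫ cut · GD = ∫ w(τ) ∫₀^τ GD dτ = 0`; the cut-feed bound
`integral_cut_mul_le`).

WHY. This is the step of the shell that turns the five tested balance laws (arriving `w`-averaged in time,
with defects `δ`) into the single weighted relative-energy inequality consumed by `window_gronwall`.

No named fact is invoked.
-/

namespace Summit.AtomisticToContinuum.HydrodynamicLimit.Theorems.ChaosClosesEulerShellWin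

open Set MeasureTheory
open Summit.AtomisticToContinuum.HydrodynamicLimit.Theorems.ChaosClosesEulerShellTime

section Pieces
variable {τ₀ Δ t : ℝ}

/-- **Exactly conserved part.** If `X(τ) − X(0) = ∫_{[0,τ]} G` on `[0, t]` (`G` integrable), then the
`w`-average of `X` is `∫_{[0,t]} w X = X(0) + ∫_{[0,t]} cut · G` (`Δ > 0`, `0 ≤ τ₀`, `τ₀ + Δ ≤ t`). [folklore] -/
theorem integral_weight_mul_of_primitive (hΔ : 0 < Δ) (hτ₀ : 0 ≤ τ₀) (ht : τ₀ + Δ ≤ t) {X G : ℝ → ℝ}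
    (hG : IntegrableOn G (Icc 0 t)) (h : ∀ τ ∈ Icc 0 t, X τ - X 0 = ∫ s in Icc 0 τ, G s) :
    ∫ τ in Icc 0 t, -deriv (fun s' => Real.smoothTransition ((τ₀ + Δ - s') / Δ)) τ * X τ =
      X 0 + ∫ s in Icc 0 t, Real.smoothTransition ((τ₀ + Δ - s) / Δ) * G s := by
  have hfun : EqOn (fun τ => -deriv (fun s' => Real.smoothTransition ((τ₀ + Δ - s') / Δ)) τ * X τ)
      (fun τ => -deriv (fun s' => Real.smoothTransition ((τ₀ + Δ - s') / Δ)) τ *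
        (X 0 + (∫ s in Icc 0 τ, G s) + 0)) (Icc 0 t) := fun τ hτ => by
    dsimp only
    rw [← h τ hτ]
    ring
  rw [setIntegral_congr_fun measurableSet_Icc hfun, integral_weight_mul_affine hΔ hτ₀ ht hG (X 0) 0,
    add_zero]

/-- **Part with a defect.** If `|X(τ) − X(0) − ∫_{[0,τ]} G| ≤ δ` on `[0, t]` (`X, G` integrable), then
`|∫_{[0,t]} w X − (X(0) + ∫_{[0,t]} cut · G)| ≤ δ` (`Δ > 0`, `0 ≤ τ₀`, `τ₀ + Δ ≤ t`). The defect
`e = X − X(0) − ∫₀^τ G` need not be assumed integrable: `w e` is the difference of two integrable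
functions. [folklore] -/
theorem abs_integral_weight_mul_sub_le (hΔ : 0 < Δ) (hτ₀ : 0 ≤ τ₀) (ht : τ₀ + Δ ≤ t) {X G : ℝ → ℝ}
    {δ : ℝ} (hX : IntegrableOn X (Icc 0 t)) (hG : IntegrableOn G (Icc 0 t))
    (h : ∀ τ ∈ Icc 0 t, |X τ - X 0 - ∫ s in Icc 0 τ, G s| ≤ δ) :
    |(∫ τ in Icc 0 t, -deriv (fun s' => Real.smoothTransition ((τ₀ + Δ - s') / Δ)) τ * X τ) -
      (X 0 + ∫ s in Icc 0 t, Real.smoothTransition ((τ₀ + Δ - s) / Δ) * G s)| ≤ δ := by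
  have hA := integrableOn_weight_mul_affine hG τ₀ Δ (X 0) 0
  have hWX := integrableOn_weight_mul hX τ₀ Δ
  have hb : |∫ τ in Icc 0 t, -deriv (fun s' => Real.smoothTransition ((τ₀ + Δ - s') / Δ)) τ *
      (X τ - X 0 - ∫ s in Icc 0 τ, G s)| ≤ δ := abs_integral_weight_mul_le hΔ hτ₀ ht h
  have heq : ∫ τ in Icc 0 t, -deriv (fun s' => Real.smoothTransition ((τ₀ + Δ - s') / Δ)) τ *
      (X τ - X 0 - ∫ s in Icc 0 τ, G s) =
      (∫ τ in Icc 0 t, -deriv (fun s' => Real.smoothTransition ((τ₀ + Δ - s') / Δ)) τ * X τ) -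
      ∫ τ in Icc 0 t, -deriv (fun s' => Real.smoothTransition ((τ₀ + Δ - s') / Δ)) τ *
        (X 0 + (∫ s in Icc 0 τ, G s) + 0) := by
    rw [← integral_sub hWX hA]
    exact setIntegral_congr_fun measurableSet_Icc fun τ _ => by ring
  rw [heq, integral_weight_mul_affine hΔ hτ₀ ht hG (X 0) 0, add_zero] at hb
  exact hb

/-- **A source with vanishing primitive is invisible to the cut.** If `∫_{[0,τ]} G = 0` for every
`τ ∈ [0, t]` (`G` integrable), then `∫_{[0,t]} cut · G = ∫_{[0,t]} w(τ) ∫_{[0,τ]} G dτ = 0`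
(`Δ > 0`, `τ₀ + Δ ≤ t`). [folklore] -/
theorem integral_cut_mul_eq_zero (hΔ : 0 < Δ) (ht : τ₀ + Δ ≤ t) {G : ℝ → ℝ}
    (hG : IntegrableOn G (Icc 0 t)) (h : ∀ τ ∈ Icc 0 t, ∫ s in Icc 0 τ, G s = 0) :
    ∫ s in Icc 0 t, Real.smoothTransition ((τ₀ + Δ - s) / Δ) * G s = 0 := by
  rw [← integral_weight_mul_setIntegral_eq hΔ ht hG]
  calc ∫ τ in Icc 0 t, -deriv (fun s' => Real.smoothTransition ((τ₀ + Δ - s') / Δ)) τ *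
        ∫ s in Icc 0 τ, G s
      = ∫ τ in Icc 0 t, (0 : ℝ) :=
        setIntegral_congr_fun measurableSet_Icc fun τ hτ => by simp only [h τ hτ, mul_zero]
    _ = 0 := by simp

/-- **The cut-tested sources recombine into the residual.** If `−GM + GC − GS + GP + GD = Rp` on `(0, t)`
(all integrable on `[0, t]`), then `∫_{[0,t]} cut · Rp = −∫ cut · GM + ∫ cut · GC − ∫ cut · GS + ∫ cut · GP
+ ∫ cut · GD` (the endpoints `{0, t}` are Lebesgue-null). [folklore] -/
theorem integral_cut_mul_residual {GM GC GS GP GD Rp : ℝ → ℝ} (hGM : IntegrableOn GM (Icc 0 t))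
    (hGC : IntegrableOn GC (Icc 0 t)) (hGS : IntegrableOn GS (Icc 0 t)) (hGP : IntegrableOn GP (Icc 0 t))
    (hGD : IntegrableOn GD (Icc 0 t)) (hR : ∀ s ∈ Ioo 0 t, -GM s + GC s - GS s + GP s + GD s = Rp s)
    (τ₀ Δ : ℝ) :
    ∫ s in Icc 0 t, Real.smoothTransition ((τ₀ + Δ - s) / Δ) * Rp s =
      -(∫ s in Icc 0 t, Real.smoothTransition ((τ₀ + Δ - s) / Δ) * GM s) +
        (∫ s in Icc 0 t, Real.smoothTransition ((τ₀ + Δ - s) / Δ) * GC s) -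
        (∫ s in Icc 0 t, Real.smoothTransition ((τ₀ + Δ - s) / Δ) * GS s) +
        (∫ s in Icc 0 t, Real.smoothTransition ((τ₀ + Δ - s) / Δ) * GP s) +
        ∫ s in Icc 0 t, Real.smoothTransition ((τ₀ + Δ - s) / Δ) * GD s := by
  have iM : IntegrableOn (fun s => -(Real.smoothTransition ((τ₀ + Δ - s) / Δ) * GM s)) (Icc 0 t) :=
    (integrableOn_cut_mul hGM τ₀ Δ).neg
  have iC := integrableOn_cut_mul hGC τ₀ Δ
  have iS := integrableOn_cut_mul hGS τ₀ Δ
  have iP := integrableOn_cut_mul hGP τ₀ Δ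
  have iD := integrableOn_cut_mul hGD τ₀ Δ
  have i2 : IntegrableOn (fun s => -(Real.smoothTransition ((τ₀ + Δ - s) / Δ) * GM s) +
      Real.smoothTransition ((τ₀ + Δ - s) / Δ) * GC s) (Icc 0 t) := iM.add iC
  have i3 : IntegrableOn (fun s => -(Real.smoothTransition ((τ₀ + Δ - s) / Δ) * GM s) +
      Real.smoothTransition ((τ₀ + Δ - s) / Δ) * GC s -
      Real.smoothTransition ((τ₀ + Δ - s) / Δ) * GS s) (Icc 0 t) := i2.sub iS
  have i4 : IntegrableOn (fun s => -(Real.smoothTransition ((τ₀ + Δ - s) / Δ) * GM s) +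
      Real.smoothTransition ((τ₀ + Δ - s) / Δ) * GC s -
      Real.smoothTransition ((τ₀ + Δ - s) / Δ) * GS s +
      Real.smoothTransition ((τ₀ + Δ - s) / Δ) * GP s) (Icc 0 t) := i3.add iP
  rw [← integral_neg, ← integral_add iM iC, ← integral_sub i2 iS, ← integral_add i3 iP,
    ← integral_add i4 iD, integral_Icc_eq_integral_Ioo, integral_Icc_eq_integral_Ioo]
  exact setIntegral_congr_fun measurableSet_Ioo fun s hs => by
    rw [← hR s hs]
    ring

end Pieces

/-- REGISTERED SUB-GOAL `stub_bf18ShellWin` of the line `Sketch` (helper of `stub_bf18Shell`): **the weighted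
relative-energy inequality of the BF18 shell.** With the weight `w = −cut'` of a window `[τ₀, τ₀ + Δ] ⊆ [0, t]`
(`cut(s) = ζ((τ₀ + Δ − s)/Δ)`), a nonnegative integrable `F = XE − XM + XC − XS + XP` on `[0, t]` whose five
parts evolve as `XE(τ) ≤ XE(0) + δ`, `|XM(τ) − XM(0) − ∫₀^τ GM| ≤ δ`, `XC(τ) − XC(0) = ∫₀^τ GC`,
`∫ cut · GS − ∫ w · XS + XS(0) ≤ δ`, `XP(τ) − XP(0) = ∫₀^τ GP`, and whose sources recombine on `(0, t)` into
`−GM + GC − GS + GP + GD = Rp ≤ C F` with `∫₀^τ GD = 0`, satisfies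
`∫₀ᵗ w F ≤ F(0) + 3δ + C ∫₀^{τ₀+Δ} F`. [folklore] -/
theorem stub_bf18ShellWin : ∀ (t Δ τ₀ δ C : ℝ) (F Rp XE XM XC XS XP GM GC GS GP GD : ℝ → ℝ), 0 < Δ →
    0 ≤ τ₀ → τ₀ + Δ ≤ t → 0 ≤ C → IntegrableOn F (Set.Icc 0 t) → IntegrableOn Rp (Set.Icc 0 t) →
    IntegrableOn XE (Set.Icc 0 t) → IntegrableOn XM (Set.Icc 0 t) → IntegrableOn XC (Set.Icc 0 t) →
    IntegrableOn XS (Set.Icc 0 t) → IntegrableOn XP (Set.Icc 0 t) → IntegrableOn GM (Set.Icc 0 t) →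
    IntegrableOn GC (Set.Icc 0 t) → IntegrableOn GS (Set.Icc 0 t) → IntegrableOn GP (Set.Icc 0 t) →
    IntegrableOn GD (Set.Icc 0 t) → (∀ s ∈ Set.Icc 0 t, F s = XE s - XM s + XC s - XS s + XP s) →
    (∀ s ∈ Set.Icc 0 t, 0 ≤ F s) → (∀ s ∈ Set.Ioo 0 t, -GM s + GC s - GS s + GP s + GD s = Rp s) →
    (∀ s ∈ Set.Ioo 0 t, Rp s ≤ C * F s) → (∀ τ ∈ Set.Icc 0 t, ∫ s in Set.Icc 0 τ, GD s = 0) →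
    (∀ τ ∈ Set.Icc 0 t, XE τ ≤ XE 0 + δ) →
    (∀ τ ∈ Set.Icc 0 t, |XM τ - XM 0 - ∫ s in Set.Icc 0 τ, GM s| ≤ δ) →
    (∀ τ ∈ Set.Icc 0 t, XC τ - XC 0 = ∫ s in Set.Icc 0 τ, GC s) →
    ((∫ s in Set.Icc 0 t, Real.smoothTransition ((τ₀ + Δ - s) / Δ) * GS s) -
      (∫ s in Set.Icc 0 t, -deriv (fun s' => Real.smoothTransition ((τ₀ + Δ - s') / Δ)) s * XS s) +
      XS 0 ≤ δ) →
    (∀ τ ∈ Set.Icc 0 t, XP τ - XP 0 = ∫ s in Set.Icc 0 τ, GP s) →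
    ∫ s in Set.Icc 0 t, -deriv (fun s' => Real.smoothTransition ((τ₀ + Δ - s') / Δ)) s * F s ≤
      F 0 + 3 * δ + C * ∫ s in Set.Icc 0 (τ₀ + Δ), F s := by
  intro t Δ τ₀ δ C F Rp XE XM XC XS XP GM GC GS GP GD hΔ hτ₀ ht hC hF hRp hXE hXM hXC hXS hXP hGM hGC hGS
    hGP hGD hsplit hF0 hR hRF hGD0 hE hM hCC hS hP
  -- (1) the weighted integral of `F` splits into the five weighted parts
  have iE := integrableOn_weight_mul hXE τ₀ Δ
  have iM := integrableOn_weight_mul hXM τ₀ Δ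
  have iC := integrableOn_weight_mul hXC τ₀ Δ
  have iS := integrableOn_weight_mul hXS τ₀ Δ
  have iP := integrableOn_weight_mul hXP τ₀ Δ
  have i2 : IntegrableOn (fun s => -deriv (fun s' => Real.smoothTransition ((τ₀ + Δ - s') / Δ)) s * XE s -
      -deriv (fun s' => Real.smoothTransition ((τ₀ + Δ - s') / Δ)) s * XM s) (Icc 0 t) := iE.sub iM
  have i3 : IntegrableOn (fun s => -deriv (fun s' => Real.smoothTransition ((τ₀ + Δ - s') / Δ)) s * XE s -
      -deriv (fun s' => Real.smoothTransition ((τ₀ + Δ - s') / Δ)) s * XM s +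
      -deriv (fun s' => Real.smoothTransition ((τ₀ + Δ - s') / Δ)) s * XC s) (Icc 0 t) := i2.add iC
  have i4 : IntegrableOn (fun s => -deriv (fun s' => Real.smoothTransition ((τ₀ + Δ - s') / Δ)) s * XE s -
      -deriv (fun s' => Real.smoothTransition ((τ₀ + Δ - s') / Δ)) s * XM s +
      -deriv (fun s' => Real.smoothTransition ((τ₀ + Δ - s') / Δ)) s * XC s -
      -deriv (fun s' => Real.smoothTransition ((τ₀ + Δ - s') / Δ)) s * XS s) (Icc 0 t) := i3.sub iS
  have h1 : ∫ s in Icc 0 t, -deriv (fun s' => Real.smoothTransition ((τ₀ + Δ - s') / Δ)) s * F s =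
      (∫ s in Icc 0 t, -deriv (fun s' => Real.smoothTransition ((τ₀ + Δ - s') / Δ)) s * XE s) -
      (∫ s in Icc 0 t, -deriv (fun s' => Real.smoothTransition ((τ₀ + Δ - s') / Δ)) s * XM s) +
      (∫ s in Icc 0 t, -deriv (fun s' => Real.smoothTransition ((τ₀ + Δ - s') / Δ)) s * XC s) -
      (∫ s in Icc 0 t, -deriv (fun s' => Real.smoothTransition ((τ₀ + Δ - s') / Δ)) s * XS s) +
      ∫ s in Icc 0 t, -deriv (fun s' => Real.smoothTransition ((τ₀ + Δ - s') / Δ)) s * XP s := by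
    rw [← integral_sub iE iM, ← integral_add i2 iC, ← integral_sub i3 iS, ← integral_add i4 iP]
    exact setIntegral_congr_fun measurableSet_Icc fun s hs => by
      rw [hsplit s hs]
      ring
  -- (2)-(6) the five weighted parts
  have h2 : ∫ s in Icc 0 t, -deriv (fun s' => Real.smoothTransition ((τ₀ + Δ - s') / Δ)) s * XE s ≤
      XE 0 + δ := integral_weight_mul_le_of_le hΔ hτ₀ ht hXE hE
  have h3 := (abs_le.1 (abs_integral_weight_mul_sub_le hΔ hτ₀ ht hXM hGM hM)).1
  have h4 := integral_weight_mul_of_primitive hΔ hτ₀ ht hGC hCC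
  have h6 := integral_weight_mul_of_primitive hΔ hτ₀ ht hGP hP
  -- (7)-(9) the cut-tested sources: recombination, the invisible source `GD`, the cut-feed bound
  have h7 := integral_cut_mul_residual hGM hGC hGS hGP hGD hR τ₀ Δ
  have h8 := integral_cut_mul_eq_zero hΔ ht hGD hGD0
  have h9 := integral_cut_mul_le hΔ ht hF hRp hF0 hC hRF
  -- the splitting at `s = 0`
  have h0 : F 0 = XE 0 - XM 0 + XC 0 - XS 0 + XP 0 := hsplit 0 ⟨le_rfl, by linarith⟩
  rw [h1]
  linarith

end Summit.AtomisticToContinuum.HydrodynamicLimit.Theorems.ChaosClosesEulerShellWin
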